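import Summits.QuantumFields.YangMills.Theorems.UnitScaleTiltProp7SectET3LandauOpRows127T3
import Summits.QuantumFields.YangMills.Theorems.UnitScaleTiltProp7Eq130OfEq128T3
import HarnessLib

/-!
# Route `UnitScaleTilt`, crux «MinimiserStabilityRegPr» (stmt-QuantumFields-19200, stub EX), node N06(d = 3), route (α) — LAYER 0, ROWS (def-free):
# **«OP-ROWS-ETA» — `hΔsol`'s SECOND-ORDER SUPPLIER AT A GENERIC HESSIAN SLOT WITH THE SOLUTION'S SLICE ROWS IN PLACE OF THE OPERATOR GUARDS.**  The sibling of
# ✓`Prop7SectET3LandauOpRows127` ruled by the EX-knit namer ★ym-ust-19200-w2 g6 2026-08-28 22:31:58Z («px5: OPROWS-ETA GO») after ★px21's located hazard «HMULT-127» (#57) and ★px16's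
# caveat: at print's slot `Δx := Δ^η` ([Balaban1985Variational] (128)–(130) are written for `Δ_a = Δ + DRD* + Q*aQ`, [Balaban1985BackgroundPropagators] (3.26) with `Δ := Δ^η`, Thm 3.3) the
# operator guards `hkill`∕`horth` («`Δx` kills ∕ is ⊥ to `D N_S`») are FALSE off critical backgrounds (the Wilson Hessian of a gauge-invariant action annihilates pure-gauge directions only
# where `J = 0`: `⟨Dλ, Δ^η w⟩ = −⟨J(U₀), (∂_w D)λ⟩`); print carries the gauge part on THE SOLUTION instead ((127): the chart value lies in the slice `R_S D*A′ = 0`, `QA′ = B̃`).  ANSWER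
# to the namer's question: in ✓p668120 the guards are load-bearing ONLY through ✓`RS_DstarL2_sol`∕✓`Qk_sol` (= the solution's Landau row and `Q`-row); so here they are REPLACED by those
# two rows as DISPLAYED HYPOTHESES `hLan : R_S(D*(toL2 Yf)) = 0`, `hQY : Q_k(toL2 Yf) = b` — slice membership of the solution, conjunct (i) of `hSplit′` — and the slot `Δx` stays GENERIC
# (so the theorem serves `DeltaEtaSlot` as ruled, and any other slot)

Cell `ym3-torus` (HUMAN RULING D-0037, YM ladder rung R3 — YM₃ on T³, NOT d = 4, NOT Clay; YM gap NOT proved), width seat `ym3-torus-px5` (gen 2; FILL-TO-CAP «width 5»).  THEOREMS ONLY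
(0 `def`, 0 `sorry`); `--supports stmt-QuantumFields-19200 --as helper`; count-neutral; NO claim on crux ∕ stub ∕ registry; nothing of [Balaban1985BackgroundPropagators] §3 is asserted.

THE DISPLAYED ROWS (member `F`, `h : n ≤ K`, weights `c₀ cB a`, slot `Δx`, background `U₀`; class `hp : PosOnto … Δx U₀` only — at `Δ^η` this is [5] Thm 3.3's positivity of `Δ_a`, `0 < a`):
* solution rows: `hY : toL2 Yf = −𝔊x + Hb` ((111)∕(129)–(130) read in `L²`), `hLan : R_S(D*(toL2 Yf)) = 0` and `hQY : Q_k(toL2 Yf) = b` ((127)∕(102): the solution is in the slice),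
  `hmult : DL2(RS(DstarL2(GT …Δx… x))) = 0` (the Landau-multiplier summand of the residual VANISHES — print's (128) «residual ∈ range Q*» consequence; displayed until the (128)-junction
  lands; NB it does NOT evaporate by re-pointing the slot: the residual `−x + Qk†(…) + D R_S D* G x + …` has the same shape at every slot).
* background rows (EX residue-row shapes of record): `hOpC′` (the tube term `Qk†((QGQ*)⁻¹(Q_k(Gx)))` = print's `P₀*`-operator of (133), η-free), `h137` (generic `Y`), `hOp139′` (slot defect
  on the Landau class), `hOp349` ((3.49)).  Sizes `hYsup∕hnY`, `hx∕hsx`, `hb∕hsb`.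

WHAT IS PROVED (ns `…Theorems.Prop7SectET3LandauOpRowsEta`):
* §1 ★★ `slot_sol_eq_of_sliceRows` — E2-133's slot row of the solution WITHOUT operator guards: `Δx U₀ (toL2 Yf) = −x + Qk†(KinvT(Qk(GT x))) + DL2(RS(DstarL2(GT x))) + Qk†(KinvT b) − Qk†(a•b)`
  from `hp`, `hY`, `hLan`, `hQY` (✓`laplaceA_sol` + ✓`laplaceA_apply`: `Δ_a = Δx + D R_S D* + Q*aQ` ((3.26)), the last two summands read on the solution by its slice rows).
* §2 ★★★ `secondOrder_of_eq111_opRowsEta` — both second-order members of (19) for `Yf`: `‖D¹*D¹Yf‖ ≤ (sx + cC′·sx + c₁₃₇·sb + k₁₃₉·nY + 28ε₀·nY)·η²`, `‖Δ¹Yf‖ ≤ (… + k₃₄₉·nY + 4ε₀·nY)·η²`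
  (§1 + `hmult` ⇒ ✓`norm_rhs127_le`; `Δ^η = Δx + (Δ^η − Δx)` with `hOp139′` at the Landau field `Yf` (`hLan`); ✓`secondOrder_of_DeltaEta_row` + ✓`hDPD_of_op349`).
* §3 ★★★ `secondOrder_of_eq111_opRowsEta_rho` — the junction currency `≤ MΔ·ρ·η²`, `MΔ := cx + cC′·cx + c₁₃₇·cb + k₁₃₉·B₁∕2 + 14B₁ + k₃₄₉·B₁∕2 + 2B₁` (✓p668120's polynomial).
INHABITABILITY (№9 (3)): `hLan`∕`hQY` are identities about the solution (print's slice; conjunct (i) of `hSplit′`); `hmult` = (128)'s consequence (★px21 HEQ-DELTA lineage); the background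
rows as recorded in ✓p663021∕✓p668120; no Calderón–Zygmund operator (defect №6 stays cured).
HONEST SCOPE.  Compositions by name + triangle inequalities; nothing of N06(d = 3) or Sect. C proved; not a proof of any stub; nothing continuum ∕ OS ∕ mass-gap ∕ Clay.

References: T. Bałaban, CMP **102** (1985) 277–309 [Balaban1985Variational] ((102) p.293, (111) p.294, (127)–(130) p.297, (133)–(137) p.298, (139)–(140) p.299, (19) p.281); CMP **99**
(1985) 389–434 [Balaban1985BackgroundPropagators] ((3.26)–(3.27) p.395, Thm 3.3 (3.42) p.397, (3.49) p.399, (3.126) p.420, (3.147) p.425, (3.153) p.426).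
-/
set_option autoImplicit false

noncomputable section

open scoped InnerProductSpace ComplexConjugate Matrix.Norms.L2Operator

namespace Summit.QuantumFields.YangMills.Theorems.Prop7SectET3LandauOpRowsEta

open Literature.MathematicalPhysics.QuantumFieldTheory.Balaban1983to89
open Literature.MathematicalPhysics.QuantumFieldTheory.Balaban1983to89.T3ContinuumYM3Torus
open Literature.MathematicalPhysics.QuantumFieldTheory.Balaban1983to89.T3PrintedRegularMinimiser (RegPr)
open T3SectALandauChart (eta eta_pos covDerivFwdT covCodiffCurlT covLapFormT covDivFormT bgUnits)
open B9SectCLatticeCarrier (Bond)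
open B9Eq311L2Pairing (WL2)
open B11Eq103H1Complex (SiteL2K BondL2K)
open Summit.QuantumFields.YangMills.Theorems.Prop7SectET3Transport (periodsT3)
open Summit.QuantumFields.YangMills.Theorems.Prop7SectET3HilbertLetters (W₂ toL2 toL2S toL2B DL2 DstarL2)
open Summit.QuantumFields.YangMills.Theorems.Prop7SectET3GaugeProjector (NS RS)
open Summit.QuantumFields.YangMills.Theorems.Prop7SectET3WilsonHessian (DeltaEta)
open Summit.QuantumFields.YangMills.Theorems.Prop7SectET3CurvedPropagators
open Summit.QuantumFields.YangMills.Theorems.Prop7SectET3DeltaPi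
open Summit.QuantumFields.YangMills.Theorems.Prop7HessRowOfEq111 (laplaceA_sol secondOrder_of_DeltaEta_row)
open Summit.QuantumFields.YangMills.Theorems.Prop7SectET3LandauOpRows127 (k_nonneg_of_opCprime hCprime_of_opCprime k_nonneg_of_op137_slot h137_of_genericY_slot k_nonneg_of_op139prime)
open Summit.QuantumFields.YangMills.Theorems.Prop7Eq130OfEq128 (slot_eq_of_eq128_landau)
open Summit.QuantumFields.YangMills.Theorems.Prop7SectET3LandauOpRows (hDPD_of_op349 k_nonneg_of_op349)

variable {F : T3Family} {n K : ℕ} {h : n ≤ K} {c₀ cB a : ℝ} [Fact (0 < c₀)] [Fact (0 < cB)]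
  {Δx : GaugeField (F.P K) 0 (Matrix.specialUnitaryGroup (Fin 2) ℂ) → (BondL2K ℂ 3 (periodsT3 F K) c₀ W₂ →ₗ[ℂ] BondL2K ℂ 3 (periodsT3 F K) c₀ W₂)}

/-! ## §1 E2-133's slot row of the solution from its SLICE ROWS (no operator guard) -/

/-- ★★ **THE HESSIAN-SLOT ROW OF THE SOLUTION FROM ITS SLICE ROWS** — for `Y = −𝔊x + Hb` on the class `PosOnto … Δx U₀`: `Δ_a Y = −𝔓*x + Q_k†((QGQ*)⁻¹b)` (✓`laplaceA_sol`, (3.153)∕(3.126)) and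
`Δ_a = Δx + D R_S D* + Q*aQ` ((3.26), ✓`laplaceA_apply`); reading the last two summands ON THE SOLUTION by its slice rows `R_S D*Y = 0` ((127)∕(102)L) and `Q_kY = b` ((102)∕(45)) gives
`Δx Y = −x + Q_k†((QGQ*)⁻¹(Q_k(Gx))) + D(R_S(D*(Gx))) + Q_k†((QGQ*)⁻¹b) − Q_k†(a • b)` — ✓`slot_sol_eq`'s text with the guards `hΔ hΔ′` REPLACED by `hLan hQY` (valid at `Δ^η`, where the guards fail
off critical backgrounds). [cite: Balaban1985Variational, (102) p.293, (127)–(129) p.297, (133) p.298; Balaban1985BackgroundPropagators, (3.26) p.395, (3.153) p.426] -/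
theorem slot_sol_eq_of_sliceRows {U₀ : GaugeField (F.P K) 0 (Matrix.specialUnitaryGroup (Fin 2) ℂ)} (hp : PosOnto F n K h c₀ cB a Δx U₀)
    (x : BondL2K ℂ 3 (periodsT3 F K) c₀ W₂) (b : WL2 ℂ (fun _ : PBond (F.P n) 0 => cB) W₂) (Yf : PBond (F.P K) 0 → Matrix (Fin 2) (Fin 2) ℂ)
    (hY : toL2 F K c₀ Yf = -(frakGT F n K h c₀ cB a Δx U₀ x) + HT F n K h c₀ cB a Δx U₀ b)
    (hLan : RS F n K h c₀ cB U₀ (DstarL2 F n K c₀ U₀ (toL2 F K c₀ Yf)) = 0) (hQY : Qk F n K h c₀ cB U₀ (toL2 F K c₀ Yf) = b) :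
    Δx U₀ (toL2 F K c₀ Yf)
      = -x + LinearMap.adjoint (Qk F n K h c₀ cB U₀) (KinvT F n K h c₀ cB a Δx U₀ (Qk F n K h c₀ cB U₀ (GT F n K h c₀ cB a Δx U₀ x)))
          + DL2 F n K c₀ U₀ (RS F n K h c₀ cB U₀ (DstarL2 F n K c₀ U₀ (GT F n K h c₀ cB a Δx U₀ x)))
          + LinearMap.adjoint (Qk F n K h c₀ cB U₀) (KinvT F n K h c₀ cB a Δx U₀ b)
          - LinearMap.adjoint (Qk F n K h c₀ cB U₀) (((a : ℂ)) • b) := by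
  have h1 := laplaceA_sol hp x b
  rw [← hY, laplaceA_apply, hLan, hQY, map_zero, add_zero] at h1
  -- `h1 : Δx Y + Qk†(a • b) = −x + Qk†KinvTQkGx + D R_S D* G x + Qk†KinvT b`
  rw [← h1, add_sub_cancel_right]

/-! ## §2 The sup row of the MULTIPLIER-FREE residual — print's (133)+(137) -/

/-- ★★ **THE SUP ROW OF THE (128)∕(133)-RESIDUAL** `‖toL2⁻¹(−x + Qk†KinvTQkGx + Qk†KinvT b̃ − Qk†(a•b̃))(bd)‖ ≤ sx + cC′·sx + c₁₃₇·‖B̃‖`-form: from the benign tube row `hOpC′`, the generic-`Y` (137) row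
`h137` read at `Y := B̃`, and the size of `x` — NO multiplier summand (print's (133) has none). [cite: Balaban1985Variational, (133) p.298, (137) p.298] -/
theorem norm_rhs128_le (U₀ : GaugeField (F.P K) 0 (Matrix.specialUnitaryGroup (Fin 2) ℂ)) {cC c137 sx sb : ℝ}
    (x : BondL2K ℂ 3 (periodsT3 F K) c₀ W₂) (b : PBond (F.P n) 0 → Matrix (Fin 2) (Fin 2) ℂ)
    (hx : ∀ bd, ‖(toL2 F K c₀).symm x bd‖ ≤ sx) (hb : ∀ c : PBond (F.P n) 0, ‖b c‖ ≤ sb)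
    (hOpC : ∀ (x : BondL2K ℂ 3 (periodsT3 F K) c₀ W₂) (bd : PBond (F.P K) 0),
      ‖(toL2 F K c₀).symm (LinearMap.adjoint (Qk F n K h c₀ cB U₀) (KinvT F n K h c₀ cB a Δx U₀ (Qk F n K h c₀ cB U₀ (GT F n K h c₀ cB a Δx U₀ x)))) bd‖
        ≤ cC * ‖(toL2 F K c₀).symm x‖)
    (h137 : ∀ (Y : PBond (F.P n) 0 → Matrix (Fin 2) (Fin 2) ℂ) (b : PBond (F.P K) 0),
      ‖(toL2 F K c₀).symm (LinearMap.adjoint (Qk F n K h c₀ cB U₀) (KinvT F n K h c₀ cB a Δx U₀ (toL2B F n cB Y))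
          - LinearMap.adjoint (Qk F n K h c₀ cB U₀) (((a : ℂ)) • toL2B F n cB Y)) b‖ ≤ c137 * ‖Y‖) (bd : PBond (F.P K) 0) :
    ‖(toL2 F K c₀).symm (-x + LinearMap.adjoint (Qk F n K h c₀ cB U₀) (KinvT F n K h c₀ cB a Δx U₀ (Qk F n K h c₀ cB U₀ (GT F n K h c₀ cB a Δx U₀ x)))
          + LinearMap.adjoint (Qk F n K h c₀ cB U₀) (KinvT F n K h c₀ cB a Δx U₀ (toL2B F n cB b))
          - LinearMap.adjoint (Qk F n K h c₀ cB U₀) (((a : ℂ)) • toL2B F n cB b)) bd‖ ≤ sx + cC * sx + c137 * sb := by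
  have hC := hCprime_of_opCprime (n := n) (h := h) (cB := cB) (a := a) U₀ hOpC x hx bd
  have hsb0 : 0 ≤ sb := (norm_nonneg _).trans (hb ⟨default, ⟨0, (F.P n).hd⟩⟩)
  have hB : ‖(toL2 F K c₀).symm (LinearMap.adjoint (Qk F n K h c₀ cB U₀) (KinvT F n K h c₀ cB a Δx U₀ (toL2B F n cB b))
          - LinearMap.adjoint (Qk F n K h c₀ cB U₀) (((a : ℂ)) • toL2B F n cB b)) bd‖ ≤ c137 * sb :=
    (h137 b bd).trans (mul_le_mul_of_nonneg_left ((pi_norm_le_iff_of_nonneg hsb0).mpr hb) (k_nonneg_of_op137_slot (h := h) U₀ h137))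
  have hsplit : (toL2 F K c₀).symm (-x + LinearMap.adjoint (Qk F n K h c₀ cB U₀) (KinvT F n K h c₀ cB a Δx U₀ (Qk F n K h c₀ cB U₀ (GT F n K h c₀ cB a Δx U₀ x)))
          + LinearMap.adjoint (Qk F n K h c₀ cB U₀) (KinvT F n K h c₀ cB a Δx U₀ (toL2B F n cB b))
          - LinearMap.adjoint (Qk F n K h c₀ cB U₀) (((a : ℂ)) • toL2B F n cB b)) bd
      = -(toL2 F K c₀).symm x bd
        + (toL2 F K c₀).symm (LinearMap.adjoint (Qk F n K h c₀ cB U₀) (KinvT F n K h c₀ cB a Δx U₀ (Qk F n K h c₀ cB U₀ (GT F n K h c₀ cB a Δx U₀ x)))) bd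
        + (toL2 F K c₀).symm (LinearMap.adjoint (Qk F n K h c₀ cB U₀) (KinvT F n K h c₀ cB a Δx U₀ (toL2B F n cB b))
            - LinearMap.adjoint (Qk F n K h c₀ cB U₀) (((a : ℂ)) • toL2B F n cB b)) bd := by
    simp only [map_add, map_sub, map_neg, Pi.add_apply, Pi.sub_apply, Pi.neg_apply]
    abel
  rw [hsplit]
  calc _ ≤ ‖-(toL2 F K c₀).symm x bd‖
          + ‖(toL2 F K c₀).symm (LinearMap.adjoint (Qk F n K h c₀ cB U₀) (KinvT F n K h c₀ cB a Δx U₀ (Qk F n K h c₀ cB U₀ (GT F n K h c₀ cB a Δx U₀ x)))) bd‖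
          + ‖(toL2 F K c₀).symm (LinearMap.adjoint (Qk F n K h c₀ cB U₀) (KinvT F n K h c₀ cB a Δx U₀ (toL2B F n cB b))
              - LinearMap.adjoint (Qk F n K h c₀ cB U₀) (((a : ℂ)) • toL2B F n cB b)) bd‖ := norm_add₃_le
    _ ≤ sx + cC * sx + c137 * sb := by rw [norm_neg]; exact add_le_add (add_le_add (hx bd) hC) hB

/-! ## §3 Both second-order members of (19) for the solution FROM PRINT'S (127)+(128) — no guard, no multiplier -/

set_option maxHeartbeats 400000 in
-- HEARTBEAT rule (README): the statement carries the member's full letter terms (`LinearMap.adjoint (Qk …)`, `KinvT`, `GT`); siblings ✓p668120 §3∕§4 measured in the same class.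
/-- ★★★ **`hΔsol`'s SUPPLIER ON PRINT'S ROUTE (127)+(128) ⇒ (129)–(130) ⇒ (133) ⇒ (136), GENERIC SLOT** — for a field `Yf` whose `L²` image is LANDAU (`hLan`, (127)∕(102)L), satisfies the averaging
constraint `Q_k(toL2 Yf) = B̃̃` (`hQY`, (102)∕(45)) and print's (128) IN HILBERT FORM `Δx(toL2 Yf) + x = Q_k†μ` (`h128`; `x = Ĵ + Ŵ`), on `RegPr ε₀ U₀ ∧ PosOnto … Δx U₀`: both second-order
members of (19) are bounded, `‖D¹*D¹Yf‖ ≤ (sx + cC′·sx + c₁₃₇·sb + k₁₃₉·nY + 28ε₀·nY)·η²`, `‖Δ¹Yf‖ ≤ (… + k₃₄₉·nY + 4ε₀·nY)·η²`, from the background rows `hOpC′ h137 hOp139′ hOp349` and the sizes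
`hYsup hx hb` — via ★px21's ✓`Prop7Eq130OfEq128.slot_eq_of_eq128_landau` (the slot row WITHOUT the Landau multiplier: print's reader `𝔊₀ = G − H₀QG`), §2, `Δ^η = Δx + (Δ^η − Δx)` with
`hOp139′` at the Landau field, ✓`secondOrder_of_DeltaEta_row` + ✓`hDPD_of_op349`.  NO `hkill`∕`horth`, NO `hmult`, NO (3.124).
[cite: Balaban1985Variational, (127)–(130) p.297, (133)–(137) p.298, (139)–(140) p.299, (19) p.281; Balaban1985BackgroundPropagators, (3.26) p.395, Thm 3.3 p.397, (3.49) p.399, (3.126) p.420] -/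
theorem secondOrder_of_eq128_opRowsEta {ε₀ : ℝ} {U₀ : GaugeField (F.P K) 0 (Matrix.specialUnitaryGroup (Fin 2) ℂ)} (hU₀ : RegPr F n K ε₀ U₀)
    (hp : PosOnto F n K h c₀ cB a Δx U₀)
    (x : BondL2K ℂ 3 (periodsT3 F K) c₀ W₂) (b : PBond (F.P n) 0 → Matrix (Fin 2) (Fin 2) ℂ) (μ : WL2 ℂ (fun _ : PBond (F.P n) 0 => cB) W₂)
    (Yf : PBond (F.P K) 0 → Matrix (Fin 2) (Fin 2) ℂ)
    (hLan : RS F n K h c₀ cB U₀ (DstarL2 F n K c₀ U₀ (toL2 F K c₀ Yf)) = 0) (hQY : Qk F n K h c₀ cB U₀ (toL2 F K c₀ Yf) = toL2B F n cB b)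
    (h128 : Δx U₀ (toL2 F K c₀ Yf) + x = LinearMap.adjoint (Qk F n K h c₀ cB U₀) μ)
    {nY sx sb cC c137 k139 k349 : ℝ} (hYsup : ∀ bd, ‖Yf bd‖ ≤ nY)
    (hx : ∀ bd, ‖(toL2 F K c₀).symm x bd‖ ≤ sx) (hb : ∀ c : PBond (F.P n) 0, ‖b c‖ ≤ sb)
    (hOpC : ∀ (x : BondL2K ℂ 3 (periodsT3 F K) c₀ W₂) (bd : PBond (F.P K) 0),
      ‖(toL2 F K c₀).symm (LinearMap.adjoint (Qk F n K h c₀ cB U₀) (KinvT F n K h c₀ cB a Δx U₀ (Qk F n K h c₀ cB U₀ (GT F n K h c₀ cB a Δx U₀ x)))) bd‖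
        ≤ cC * ‖(toL2 F K c₀).symm x‖)
    (h137 : ∀ (Y : PBond (F.P n) 0 → Matrix (Fin 2) (Fin 2) ℂ) (b : PBond (F.P K) 0),
      ‖(toL2 F K c₀).symm (LinearMap.adjoint (Qk F n K h c₀ cB U₀) (KinvT F n K h c₀ cB a Δx U₀ (toL2B F n cB Y))
          - LinearMap.adjoint (Qk F n K h c₀ cB U₀) (((a : ℂ)) • toL2B F n cB Y)) b‖ ≤ c137 * ‖Y‖)
    (hOp139 : ∀ (X : PBond (F.P K) 0 → Matrix (Fin 2) (Fin 2) ℂ) (s : ℝ), RS F n K h c₀ cB U₀ (DstarL2 F n K c₀ U₀ (toL2 F K c₀ X)) = 0 → (∀ bd, ‖X bd‖ ≤ s) →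
      ∀ bd : PBond (F.P K) 0, ‖(toL2 F K c₀).symm (DeltaEta F n K c₀ U₀ (toL2 F K c₀ X) - Δx U₀ (toL2 F K c₀ X)) bd‖ ≤ k139 * s)
    (hOp349 : ∀ (X : PBond (F.P K) 0 → Matrix (Fin 2) (Fin 2) ℂ) (s : ℝ), (∀ bd, ‖X bd‖ ≤ s) → ∀ bd : PBond (F.P K) 0,
      ‖(toL2 F K c₀).symm (DL2 F n K c₀ U₀ (DstarL2 F n K c₀ U₀ (toL2 F K c₀ X) - RS F n K h c₀ cB U₀ (DstarL2 F n K c₀ U₀ (toL2 F K c₀ X)))) bd‖ ≤ k349 * s) :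
    (∀ (μ : Fin (F.P K).d) (y : Site (F.P K) 0),
      ‖covCodiffCurlT 1 (bgUnits F K U₀) Yf μ y‖ ≤ (sx + cC * sx + c137 * sb + k139 * nY + 28 * ε₀ * nY) * eta F n K ^ 2) ∧
    (∀ (ν : Fin (F.P K).d) (y : Site (F.P K) 0),
      ‖covLapFormT 1 (bgUnits F K U₀) Yf ν y‖ ≤ (sx + cC * sx + c137 * sb + k139 * nY + 28 * ε₀ * nY + k349 * nY + 4 * ε₀ * nY) * eta F n K ^ 2) := by
  -- the slot row of the solution, multiplier-free (print's (129)–(130) reader), and its sup row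
  have hslot := slot_eq_of_eq128_landau hp hLan hQY h128
  have hrhs := norm_rhs128_le (n := n) (h := h) U₀ x b hx hb hOpC h137
  -- `Δ^η = Δx + (Δ^η − Δx)` at the solution
  have hZ : DeltaEta F n K c₀ U₀ (toL2 F K c₀ Yf)
      = Δx U₀ (toL2 F K c₀ Yf) + (DeltaEta F n K c₀ U₀ (toL2 F K c₀ Yf) - Δx U₀ (toL2 F K c₀ Yf)) := by abel
  refine secondOrder_of_DeltaEta_row hU₀ Yf _ hZ hYsup (fun bd => ?_) (hDPD_of_op349 (h := h) (cB := cB) U₀ hOp349 Yf hLan hYsup)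
  rw [map_add, Pi.add_apply]
  refine (norm_add_le _ _).trans (add_le_add ?_ (hOp139 Yf nY hLan hYsup bd))
  rw [hslot]
  exact hrhs bd

/-! ## §4 The junction currency `≤ MΔ·ρ·η²` -/

set_option maxHeartbeats 400000 in
-- HEARTBEAT rule (README): as above (full letter terms in the statement).
/-- ★★★ **THE JUNCTION CURRENCY ON PRINT'S ROUTE, GENERIC SLOT** — with the sizes ρ-small (`nY ≤ B₁∕2·ρ`, `sx ≤ cx·ρ`, `‖B̃‖ ≤ cb·ρ`, `ρ ≤ 1` the `RegPr` radius) both second-order members of (19) for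
`Yf` are `≤ MΔ·ρ·η²`, **`MΔ := cx + cC′·cx + c₁₃₇·cb + k₁₃₉·B₁∕2 + 14B₁ + k₃₄₉·B₁∕2 + 2B₁`** (✓p668120's polynomial); displayed: `hp` (Thm 3.3 at `Δ^η`), the solution's `hLan hQY h128`
((127)+(45)+(128)), the background rows `hOpC′ h137 hOp139′ hOp349`, sizes. [cite: Balaban1985Variational, (127)–(130) p.297, (136) p.298, p.299 ll.6–21, (19) p.281; Balaban1985BackgroundPropagators, (3.42) p.397, (3.49) p.399] -/
theorem secondOrder_of_eq128_opRowsEta_rho {ρ : ℝ} (hρ : 0 ≤ ρ) (hρ1 : ρ ≤ 1) {U₀ : GaugeField (F.P K) 0 (Matrix.specialUnitaryGroup (Fin 2) ℂ)} (hU₀ : RegPr F n K ρ U₀)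
    (hp : PosOnto F n K h c₀ cB a Δx U₀)
    (x : BondL2K ℂ 3 (periodsT3 F K) c₀ W₂) (b : PBond (F.P n) 0 → Matrix (Fin 2) (Fin 2) ℂ) (μ : WL2 ℂ (fun _ : PBond (F.P n) 0 => cB) W₂)
    (Yf : PBond (F.P K) 0 → Matrix (Fin 2) (Fin 2) ℂ)
    (hLan : RS F n K h c₀ cB U₀ (DstarL2 F n K c₀ U₀ (toL2 F K c₀ Yf)) = 0) (hQY : Qk F n K h c₀ cB U₀ (toL2 F K c₀ Yf) = toL2B F n cB b)
    (h128 : Δx U₀ (toL2 F K c₀ Yf) + x = LinearMap.adjoint (Qk F n K h c₀ cB U₀) μ)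
    {nY sx sb B₁ cx cb cC c137 k139 k349 : ℝ} (hYsup : ∀ bd, ‖Yf bd‖ ≤ nY) (hnY : nY ≤ B₁ / 2 * ρ)
    (hx : ∀ bd, ‖(toL2 F K c₀).symm x bd‖ ≤ sx) (hsx : sx ≤ cx * ρ)
    (hb : ∀ c : PBond (F.P n) 0, ‖b c‖ ≤ sb) (hsb : sb ≤ cb * ρ)
    (hOpC : ∀ (x : BondL2K ℂ 3 (periodsT3 F K) c₀ W₂) (bd : PBond (F.P K) 0),
      ‖(toL2 F K c₀).symm (LinearMap.adjoint (Qk F n K h c₀ cB U₀) (KinvT F n K h c₀ cB a Δx U₀ (Qk F n K h c₀ cB U₀ (GT F n K h c₀ cB a Δx U₀ x)))) bd‖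
        ≤ cC * ‖(toL2 F K c₀).symm x‖)
    (h137 : ∀ (Y : PBond (F.P n) 0 → Matrix (Fin 2) (Fin 2) ℂ) (b : PBond (F.P K) 0),
      ‖(toL2 F K c₀).symm (LinearMap.adjoint (Qk F n K h c₀ cB U₀) (KinvT F n K h c₀ cB a Δx U₀ (toL2B F n cB Y))
          - LinearMap.adjoint (Qk F n K h c₀ cB U₀) (((a : ℂ)) • toL2B F n cB Y)) b‖ ≤ c137 * ‖Y‖)
    (hOp139 : ∀ (X : PBond (F.P K) 0 → Matrix (Fin 2) (Fin 2) ℂ) (s : ℝ), RS F n K h c₀ cB U₀ (DstarL2 F n K c₀ U₀ (toL2 F K c₀ X)) = 0 → (∀ bd, ‖X bd‖ ≤ s) →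
      ∀ bd : PBond (F.P K) 0, ‖(toL2 F K c₀).symm (DeltaEta F n K c₀ U₀ (toL2 F K c₀ X) - Δx U₀ (toL2 F K c₀ X)) bd‖ ≤ k139 * s)
    (hOp349 : ∀ (X : PBond (F.P K) 0 → Matrix (Fin 2) (Fin 2) ℂ) (s : ℝ), (∀ bd, ‖X bd‖ ≤ s) → ∀ bd : PBond (F.P K) 0,
      ‖(toL2 F K c₀).symm (DL2 F n K c₀ U₀ (DstarL2 F n K c₀ U₀ (toL2 F K c₀ X) - RS F n K h c₀ cB U₀ (DstarL2 F n K c₀ U₀ (toL2 F K c₀ X)))) bd‖ ≤ k349 * s) :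
    (∀ (μ : Fin (F.P K).d) (y : Site (F.P K) 0),
      ‖covCodiffCurlT 1 (bgUnits F K U₀) Yf μ y‖ ≤ (cx + cC * cx + c137 * cb + k139 * B₁ / 2 + 14 * B₁ + k349 * B₁ / 2 + 2 * B₁) * ρ * eta F n K ^ 2) ∧
    (∀ (ν : Fin (F.P K).d) (y : Site (F.P K) 0),
      ‖covLapFormT 1 (bgUnits F K U₀) Yf ν y‖ ≤ (cx + cC * cx + c137 * cb + k139 * B₁ / 2 + 14 * B₁ + k349 * B₁ / 2 + 2 * B₁) * ρ * eta F n K ^ 2) := by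
  obtain ⟨h1, h2⟩ := secondOrder_of_eq128_opRowsEta hU₀ hp x b μ Yf hLan hQY h128 hYsup hx hb hOpC h137 hOp139 hOp349
  have hη2 : 0 ≤ eta F n K ^ 2 := sq_nonneg _
  have hkC : 0 ≤ cC := k_nonneg_of_opCprime (n := n) (h := h) (cB := cB) (a := a) U₀ hOpC
  have hk137 : 0 ≤ c137 := k_nonneg_of_op137_slot (h := h) U₀ h137
  have hk139 : 0 ≤ k139 := k_nonneg_of_op139prime (h := h) (cB := cB) U₀ hOp139
  have hk349 : 0 ≤ k349 := k_nonneg_of_op349 (n := n) (h := h) (cB := cB) U₀ hOp349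
  have hnY0 : 0 ≤ nY := (norm_nonneg _).trans (hYsup ⟨default, ⟨0, (F.P K).hd⟩⟩)
  have hB : 0 ≤ B₁ / 2 * ρ := hnY0.trans hnY
  have e1 : sx + cC * sx + c137 * sb + k139 * nY ≤ (cx + cC * cx + c137 * cb + k139 * B₁ / 2) * ρ := by
    have a1 : cC * sx ≤ cC * (cx * ρ) := mul_le_mul_of_nonneg_left hsx hkC
    have a2 : c137 * sb ≤ c137 * (cb * ρ) := mul_le_mul_of_nonneg_left hsb hk137
    have a3 : k139 * nY ≤ k139 * (B₁ / 2 * ρ) := mul_le_mul_of_nonneg_left hnY hk139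
    nlinarith
  have e2 : 28 * ρ * nY ≤ 14 * B₁ * ρ := by
    have a1 : 28 * ρ * nY ≤ 28 * ρ * (B₁ / 2 * ρ) := mul_le_mul_of_nonneg_left hnY (by positivity)
    have a2 : 28 * ρ * (B₁ / 2 * ρ) ≤ 28 * 1 * (B₁ / 2 * ρ) := mul_le_mul_of_nonneg_right (mul_le_mul_of_nonneg_left hρ1 (by norm_num)) hB
    nlinarith
  have e3 : k349 * nY ≤ k349 * B₁ / 2 * ρ := (mul_le_mul_of_nonneg_left hnY hk349).trans_eq (by ring)
  have e4 : 4 * ρ * nY ≤ 2 * B₁ * ρ := by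
    have a1 : 4 * ρ * nY ≤ 4 * ρ * (B₁ / 2 * ρ) := mul_le_mul_of_nonneg_left hnY (by positivity)
    have a2 : 4 * ρ * (B₁ / 2 * ρ) ≤ 4 * 1 * (B₁ / 2 * ρ) := mul_le_mul_of_nonneg_right (mul_le_mul_of_nonneg_left hρ1 (by norm_num)) hB
    nlinarith
  refine ⟨fun μ' y => (h1 μ' y).trans ?_, fun ν y => (h2 ν y).trans ?_⟩
  · have hs : sx + cC * sx + c137 * sb + k139 * nY + 28 * ρ * nY ≤ (cx + cC * cx + c137 * cb + k139 * B₁ / 2 + 14 * B₁ + k349 * B₁ / 2 + 2 * B₁) * ρ := by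
      have hk : 0 ≤ k349 * B₁ / 2 * ρ := by
        have := mul_nonneg hk349 hB; linarith [this, e3, mul_nonneg hk349 hnY0]
      nlinarith
    calc (sx + cC * sx + c137 * sb + k139 * nY + 28 * ρ * nY) * eta F n K ^ 2
        ≤ ((cx + cC * cx + c137 * cb + k139 * B₁ / 2 + 14 * B₁ + k349 * B₁ / 2 + 2 * B₁) * ρ) * eta F n K ^ 2 := mul_le_mul_of_nonneg_right hs hη2
      _ = _ := by ring
  · have hs : sx + cC * sx + c137 * sb + k139 * nY + 28 * ρ * nY + k349 * nY + 4 * ρ * nY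
        ≤ (cx + cC * cx + c137 * cb + k139 * B₁ / 2 + 14 * B₁ + k349 * B₁ / 2 + 2 * B₁) * ρ := by nlinarith
    calc (sx + cC * sx + c137 * sb + k139 * nY + 28 * ρ * nY + k349 * nY + 4 * ρ * nY) * eta F n K ^ 2
        ≤ ((cx + cC * cx + c137 * cb + k139 * B₁ / 2 + 14 * B₁ + k349 * B₁ / 2 + 2 * B₁) * ρ) * eta F n K ^ 2 := mul_le_mul_of_nonneg_right hs hη2
      _ = _ := by ring

end Summit.QuantumFields.YangMills.Theorems.Prop7SectET3LandauOpRowsEta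

end
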